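import Summits.Parity.GeneralizedHardyLittlewood.Theorems.FordMaynardSieveConst01651SieveConst01651BuchstabCuts
import Summits.Parity.GeneralizedHardyLittlewood.Theorems.FordMaynardSieveConst01651SieveConst01651BuchstabTable
import Literature.Analysis.Convolution.ConvolutionPowerIntegerArithmetic
import Literature.LinearAlgebra.Matrix.ModularDiagonalSolver
import HarnessLib

/-!
# Route `FordMaynardSieveConst01651`, target `SieveConst01651` (stmt-Parity-19185), stub `stub_certValuePos` (R2):
# SOUNDNESS of the Volterra table, I — one cell and the generation walk

Def-free helper file for the definitions of `…BuchstabTable` (`tabWalk`, `tabGen`, `tabNext`, `tabRun`,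
`tabJ = 120000`, `tabK = 19812`, `tabD = 2⁴⁰`).

* List bookkeeping: `tabWalk_acc` (accumulators are prepended), `tabGen_succ` (cons form of one step), `tabGen_length`.
* One cell, abstract `Φ, Ψ` with `Ψ ≥ 0` monotone, `Φ(x) = (1 + Ψ(x − ν))/x` on `(ν, 7ν)`, `ν = K/J`:
  `cell_lower` / `cell_upper` (`⌊(D+Ψ⁻_{i−K})J/(i+1)⌋/D ≤ Φ ≤ ⌈(D+Ψ⁺_{i+1−K})J/i⌉/D` on `(x_i, x_{i+1}]`),
  `psi_lower_step` / `psi_upper_step` (directed rounding of `Ψ(x_{i+1}) = Ψ(x_i) + ∫_{cell} Φ`).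
* `tabGen_sound` — the walk invariant (induction on the number of cells); `tabRun_sound` — the five chained
  generations (`1 ≤ g ≤ 5`, all cells below `7ν`), including the shifted upper lag list `tail ++ [last]`.
* Instantiation at `ν₀ = 0.1651` with `Φ₆ = Σ_{m ≤ 6} φ_{ν₀}^{⋆m}/m!`, `Ψ(y) = ∫_{(0,y]} Φ₆` (hypotheses from
  `…BuchstabKernel`: Volterra equation, positivity, support, monotonicity): `tabRun_sound_phiSix`,
  **`phiSix_cell_bounds`** (`Φ⁻_m/D ≤ Φ₆ ≤ Φ⁺_m/D` on every cell `(x_m, x_{m+1}]`, `K ≤ m < 6K`) and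
  **`phiSix_one_bounds`** (`(D + Ψ⁻)/D ≤ Φ₆(1) ≤ (D + Ψ⁺)/D` at the entry `1128` of generation `5`, i.e. `x = 1 − ν₀`).

The kernel evaluates the whole table in ≈ 50 s (`decide`), bit-identical to the Python mirror; with it
`Φ₆(1) ∈ [3.4006671, 3.4007822]` (true `3.4007246`).

References: [FordMaynard2024PrimeSieves] arXiv:2407.14368, Theorem 7.3 (a), §8.2; A. A. Buchstab (1937).
-/

noncomputable section

open MeasureTheory Set Finset
open scoped Classical
open Literature.NumberTheory.Sieve Literature.NumberTheory.Sieve.FordMaynard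
open Literature.Analysis.Convolution

namespace Summit.Parity.GeneralizedHardyLittlewood.FordMaynardSieveConst01651SieveConst01651


/-! ### List bookkeeping of the walk -/

/-- The accumulators of `tabWalk` are prepended (reversed) to the outputs, and do not influence `pl`, `ph`. [folklore] -/
theorem tabWalk_acc (J D : ℕ) : ∀ (n i : ℕ) (ll lh : List ℕ) (pl ph : ℕ) (a b c d : List ℕ),
    (tabWalk J D i n ll lh pl ph a b c d).phiLo = a.reverse ++ (tabWalk J D i n ll lh pl ph [] [] [] []).phiLo ∧
    (tabWalk J D i n ll lh pl ph a b c d).phiHi = b.reverse ++ (tabWalk J D i n ll lh pl ph [] [] [] []).phiHi ∧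
    (tabWalk J D i n ll lh pl ph a b c d).psiLo = c.reverse ++ (tabWalk J D i n ll lh pl ph [] [] [] []).psiLo ∧
    (tabWalk J D i n ll lh pl ph a b c d).psiHi = d.reverse ++ (tabWalk J D i n ll lh pl ph [] [] [] []).psiHi ∧
    (tabWalk J D i n ll lh pl ph a b c d).pl = (tabWalk J D i n ll lh pl ph [] [] [] []).pl ∧
    (tabWalk J D i n ll lh pl ph a b c d).ph = (tabWalk J D i n ll lh pl ph [] [] [] []).ph
  | 0, i, ll, lh, pl, ph, a, b, c, d => by simp [tabWalk]
  | n + 1, i, ll, lh, pl, ph, a, b, c, d => by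
    simp only [tabWalk]
    have h1 := tabWalk_acc J D n (i + 1) ll.tail lh.tail (pl + ((D + ll.headD 0) * J) / (i + 1) / J)
      (ph + (((D + lh.headD 0) * J + i - 1) / i + J - 1) / J)
      ((((D + ll.headD 0) * J) / (i + 1)) :: a) ((((D + lh.headD 0) * J + i - 1) / i) :: b) (pl :: c) (ph :: d)
    have h2 := tabWalk_acc J D n (i + 1) ll.tail lh.tail (pl + ((D + ll.headD 0) * J) / (i + 1) / J)
      (ph + (((D + lh.headD 0) * J + i - 1) / i + J - 1) / J)
      [(((D + ll.headD 0) * J) / (i + 1))] [(((D + lh.headD 0) * J + i - 1) / i)] [pl] [ph]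
    obtain ⟨a1, b1, c1, d1, e1, f1⟩ := h1
    obtain ⟨a2, b2, c2, d2, e2, f2⟩ := h2
    refine ⟨?_, ?_, ?_, ?_, ?_, ?_⟩
    · rw [a1, a2]; simp
    · rw [b1, b2]; simp
    · rw [c1, c2]; simp
    · rw [d1, d2]; simp
    · rw [e1, e2]
    · rw [f1, f2]

/-- One step of the generation walk in cons form. [folklore] -/
theorem tabGen_succ (J D i n : ℕ) (ll lh : List ℕ) (pl ph : ℕ) :
    (tabGen J D i (n + 1) ll lh pl ph).phiLo =
        (((D + ll.headD 0) * J) / (i + 1)) ::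
          (tabGen J D (i + 1) n ll.tail lh.tail (pl + ((D + ll.headD 0) * J) / (i + 1) / J)
            (ph + (((D + lh.headD 0) * J + i - 1) / i + J - 1) / J)).phiLo ∧
    (tabGen J D i (n + 1) ll lh pl ph).phiHi =
        ((((D + lh.headD 0) * J + i - 1) / i)) ::
          (tabGen J D (i + 1) n ll.tail lh.tail (pl + ((D + ll.headD 0) * J) / (i + 1) / J)
            (ph + (((D + lh.headD 0) * J + i - 1) / i + J - 1) / J)).phiHi ∧
    (tabGen J D i (n + 1) ll lh pl ph).psiLo =
        pl :: (tabGen J D (i + 1) n ll.tail lh.tail (pl + ((D + ll.headD 0) * J) / (i + 1) / J)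
            (ph + (((D + lh.headD 0) * J + i - 1) / i + J - 1) / J)).psiLo ∧
    (tabGen J D i (n + 1) ll lh pl ph).psiHi =
        ph :: (tabGen J D (i + 1) n ll.tail lh.tail (pl + ((D + ll.headD 0) * J) / (i + 1) / J)
            (ph + (((D + lh.headD 0) * J + i - 1) / i + J - 1) / J)).psiHi ∧
    (tabGen J D i (n + 1) ll lh pl ph).pl =
        (tabGen J D (i + 1) n ll.tail lh.tail (pl + ((D + ll.headD 0) * J) / (i + 1) / J)
            (ph + (((D + lh.headD 0) * J + i - 1) / i + J - 1) / J)).pl ∧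
    (tabGen J D i (n + 1) ll lh pl ph).ph =
        (tabGen J D (i + 1) n ll.tail lh.tail (pl + ((D + ll.headD 0) * J) / (i + 1) / J)
            (ph + (((D + lh.headD 0) * J + i - 1) / i + J - 1) / J)).ph := by
  unfold tabGen
  simp only [tabWalk]
  obtain ⟨a1, b1, c1, d1, e1, f1⟩ := tabWalk_acc J D n (i + 1) ll.tail lh.tail
    (pl + ((D + ll.headD 0) * J) / (i + 1) / J) (ph + (((D + lh.headD 0) * J + i - 1) / i + J - 1) / J)
    [(((D + ll.headD 0) * J) / (i + 1))] [(((D + lh.headD 0) * J + i - 1) / i)] [pl] [ph]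
  refine ⟨?_, ?_, ?_, ?_, e1, f1⟩
  · rw [a1]; simp
  · rw [b1]; simp
  · rw [c1]; simp
  · rw [d1]; simp

/-! ### One Volterra cell: real-analytic bounds -/

/-- **Lower cell bound.**  If `Ψ ≥ 0` is monotone, `Φ(x) = (1 + Ψ(x − ν))/x` on `(ν, 7ν)` with `ν = K/J`, and the lag
`L/D ≤ Ψ(x_{i−K})` with `K ≤ i`, `i + 1 < 7K`, then `⌊(D+L)J/(i+1)⌋/D ≤ Φ(x)` on the cell `(x_i, x_{i+1}]`. [folklore] -/
theorem cell_lower {Φ Ψ : ℝ → ℝ} {J K D : ℕ} (hJ : 0 < J) (hD : 0 < D) (hΨm : Monotone Ψ) (hΨ0 : ∀ y, 0 ≤ Ψ y)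
    (hvolt : ∀ x, (K : ℝ) / J < x → x < 7 * ((K : ℝ) / J) → Φ x = (1 + Ψ (x - K / J)) / x)
    {i L : ℕ} (hi : K ≤ i) (hi7 : i + 1 < 7 * K) (hL : (L : ℝ) / D ≤ Ψ (((i - K : ℕ) : ℝ) / J))
    {x : ℝ} (hx : x ∈ Set.Ioc ((i : ℝ) / J) (((i : ℝ) + 1) / J)) :
    ((((D + L) * J) / (i + 1) : ℕ) : ℝ) / D ≤ Φ x := by
  have hJr : (0 : ℝ) < J := by exact_mod_cast hJ
  have hDr : (0 : ℝ) < D := by exact_mod_cast hD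
  have hx1 : (i : ℝ) / J < x := hx.1
  have hx2 : x ≤ ((i : ℝ) + 1) / J := hx.2
  have hνx : (K : ℝ) / J < x := lt_of_le_of_lt (div_le_div_of_nonneg_right (by exact_mod_cast hi) hJr.le) hx1
  have hx7 : x < 7 * ((K : ℝ) / J) := by
    refine lt_of_le_of_lt hx2 ?_
    rw [← mul_div_assoc, div_lt_div_iff_of_pos_right hJr]
    exact_mod_cast hi7
  have hxpos : 0 < x := lt_of_le_of_lt (by positivity) hνx
  have hi1 : (0 : ℝ) < (i : ℝ) + 1 := by positivity
  rw [hvolt x hνx hx7]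
  have hnum : (1 : ℝ) + L / D ≤ 1 + Ψ (x - K / J) := by
    have : Ψ (((i - K : ℕ) : ℝ) / J) ≤ Ψ (x - K / J) :=
      hΨm (by rw [Nat.cast_sub hi, sub_div]; linarith)
    linarith
  have hpos : 0 ≤ 1 + Ψ (x - K / J) := by linarith [hΨ0 (x - K / J)]
  calc ((((D + L) * J) / (i + 1) : ℕ) : ℝ) / D ≤ ((((D + L) * J : ℕ) : ℝ) / ((i : ℝ) + 1)) / D := by
        gcongr
        have h := Nat.cast_div_le (α := ℝ) (m := (D + L) * J) (n := i + 1)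
        push_cast at h ⊢
        exact h
    _ = (1 + L / D) / (((i : ℝ) + 1) / J) := by
        field_simp
        push_cast
        ring
    _ ≤ (1 + Ψ (x - K / J)) / (((i : ℝ) + 1) / J) := by gcongr
    _ ≤ (1 + Ψ (x - K / J)) / x := div_le_div_of_nonneg_left hpos hxpos hx2

/-- **Upper cell bound.**  With the lag `Ψ(x_{i+1−K}) ≤ L/D`, `1 ≤ K ≤ i`, `i + 1 < 7K`:
`Φ(x) ≤ ⌈(D+L)J/i⌉/D` on the cell `(x_i, x_{i+1}]` (`⌈a/b⌉ = (a + b − 1)/b`). [folklore] -/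
theorem cell_upper {Φ Ψ : ℝ → ℝ} {J K D : ℕ} (hJ : 0 < J) (hD : 0 < D) (hΨm : Monotone Ψ)
    (hvolt : ∀ x, (K : ℝ) / J < x → x < 7 * ((K : ℝ) / J) → Φ x = (1 + Ψ (x - K / J)) / x)
    {i L : ℕ} (hK : 1 ≤ K) (hi : K ≤ i) (hi7 : i + 1 < 7 * K) (hL : Ψ (((i + 1 - K : ℕ) : ℝ) / J) ≤ (L : ℝ) / D)
    {x : ℝ} (hx : x ∈ Set.Ioc ((i : ℝ) / J) (((i : ℝ) + 1) / J)) :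
    Φ x ≤ ((((D + L) * J + i - 1) / i : ℕ) : ℝ) / D := by
  have hJr : (0 : ℝ) < J := by exact_mod_cast hJ
  have hDr : (0 : ℝ) < D := by exact_mod_cast hD
  have hx1 : (i : ℝ) / J < x := hx.1
  have hx2 : x ≤ ((i : ℝ) + 1) / J := hx.2
  have hνx : (K : ℝ) / J < x := lt_of_le_of_lt (div_le_div_of_nonneg_right (by exact_mod_cast hi) hJr.le) hx1
  have hx7 : x < 7 * ((K : ℝ) / J) := by
    refine lt_of_le_of_lt hx2 ?_
    rw [← mul_div_assoc, div_lt_div_iff_of_pos_right hJr]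
    exact_mod_cast hi7
  have hi0 : 0 < i := lt_of_lt_of_le hK hi
  have hir : (0 : ℝ) < i := by exact_mod_cast hi0
  have hxi : (0 : ℝ) < (i : ℝ) / J := by positivity
  have hxpos : 0 < x := lt_trans hxi hx1
  rw [hvolt x hνx hx7]
  have hnum : 1 + Ψ (x - K / J) ≤ (1 : ℝ) + L / D := by
    have : Ψ (x - K / J) ≤ Ψ (((i + 1 - K : ℕ) : ℝ) / J) :=
      hΨm (by rw [Nat.cast_sub (by omega : K ≤ i + 1), sub_div]; push_cast; linarith)
    linarith
  have hpos : 0 ≤ (1 : ℝ) + L / D := by positivity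
  calc (1 + Ψ (x - K / J)) / x ≤ (1 + L / D) / x := by gcongr
    _ ≤ (1 + L / D) / ((i : ℝ) / J) := div_le_div_of_nonneg_left hpos hxi hx1.le
    _ = ((((D + L) * J : ℕ) : ℝ) / i) / D := by
        field_simp
        push_cast
        ring
    _ ≤ ((((D + L) * J + i - 1) / i : ℕ) : ℝ) / D := by
        gcongr
        rw [div_le_iff₀ hir]
        have h := le_mul_ceilDiv ((D + L) * J) hi0
        calc (((D + L) * J : ℕ) : ℝ) ≤ ((i * (((D + L) * J + i - 1) / i) : ℕ) : ℝ) := by exact_mod_cast h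
          _ = ((((D + L) * J + i - 1) / i : ℕ) : ℝ) * i := by push_cast; ring

/-- **Lower primitive step**: `Ψ(x_{i+1}) ≥ (P + ⌊F/J⌋)/D` from `Ψ(x_i) ≥ P/D` and `Φ ≥ F/D` on the cell. [folklore] -/
theorem psi_lower_step {Φ Ψ : ℝ → ℝ} {J D : ℕ} (hJ : 0 < J) (hD : 0 < D)
    (hint : ∀ a b : ℝ, IntegrableOn Φ (Set.Ioc a b))
    (hsplit : ∀ a b : ℝ, 0 ≤ a → a ≤ b → Ψ b = Ψ a + ∫ x in Set.Ioc a b, Φ x)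
    {i P F : ℕ} (hP : (P : ℝ) / D ≤ Ψ ((i : ℝ) / J))
    (hF : ∀ x ∈ Set.Ioc ((i : ℝ) / J) (((i : ℝ) + 1) / J), (F : ℝ) / D ≤ Φ x) :
    ((P + F / J : ℕ) : ℝ) / D ≤ Ψ (((i : ℝ) + 1) / J) := by
  have hJr : (0 : ℝ) < J := by exact_mod_cast hJ
  have hDr : (0 : ℝ) < D := by exact_mod_cast hD
  have hab : (i : ℝ) / J ≤ ((i : ℝ) + 1) / J := div_le_div_of_nonneg_right (by linarith) hJr.le
  rw [hsplit _ _ (by positivity) hab]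
  have hI : (1 / (J : ℝ)) * ((F : ℝ) / D) ≤ ∫ x in Set.Ioc ((i : ℝ) / J) (((i : ℝ) + 1) / J), Φ x := by
    have hc : ∫ _ in Set.Ioc ((i : ℝ) / J) (((i : ℝ) + 1) / J), (F : ℝ) / D = (1 / (J : ℝ)) * ((F : ℝ) / D) := by
      rw [setIntegral_const, Real.volume_real_Ioc_of_le hab, smul_eq_mul]
      field_simp
      ring
    rw [← hc]
    exact setIntegral_mono_on (integrableOn_const (by rw [Real.volume_Ioc]; exact ENNReal.ofReal_ne_top))
      (hint _ _) measurableSet_Ioc hF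
  have hfl : (((F / J : ℕ) : ℝ)) ≤ (F : ℝ) / J := Nat.cast_div_le
  have h2 : ((F / J : ℕ) : ℝ) / D ≤ (1 / (J : ℝ)) * ((F : ℝ) / D) := by
    calc ((F / J : ℕ) : ℝ) / D ≤ ((F : ℝ) / J) / D := div_le_div_of_nonneg_right hfl hDr.le
      _ = (1 / (J : ℝ)) * ((F : ℝ) / D) := by ring
  calc ((P + F / J : ℕ) : ℝ) / D = (P : ℝ) / D + ((F / J : ℕ) : ℝ) / D := by push_cast; ring
    _ ≤ Ψ ((i : ℝ) / J) + (1 / (J : ℝ)) * ((F : ℝ) / D) := add_le_add hP h2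
    _ ≤ Ψ ((i : ℝ) / J) + ∫ x in Set.Ioc ((i : ℝ) / J) (((i : ℝ) + 1) / J), Φ x := by linarith

/-- **Upper primitive step**: `Ψ(x_{i+1}) ≤ (P + ⌈F/J⌉)/D` from `Ψ(x_i) ≤ P/D` and `Φ ≤ F/D` on the cell. [folklore] -/
theorem psi_upper_step {Φ Ψ : ℝ → ℝ} {J D : ℕ} (hJ : 0 < J) (hD : 0 < D)
    (hint : ∀ a b : ℝ, IntegrableOn Φ (Set.Ioc a b))
    (hsplit : ∀ a b : ℝ, 0 ≤ a → a ≤ b → Ψ b = Ψ a + ∫ x in Set.Ioc a b, Φ x)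
    {i P F : ℕ} (hP : Ψ ((i : ℝ) / J) ≤ (P : ℝ) / D)
    (hF : ∀ x ∈ Set.Ioc ((i : ℝ) / J) (((i : ℝ) + 1) / J), Φ x ≤ (F : ℝ) / D) :
    Ψ (((i : ℝ) + 1) / J) ≤ ((P + (F + J - 1) / J : ℕ) : ℝ) / D := by
  have hJr : (0 : ℝ) < J := by exact_mod_cast hJ
  have hDr : (0 : ℝ) < D := by exact_mod_cast hD
  have hab : (i : ℝ) / J ≤ ((i : ℝ) + 1) / J := div_le_div_of_nonneg_right (by linarith) hJr.le
  rw [hsplit _ _ (by positivity) hab]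
  have hI : ∫ x in Set.Ioc ((i : ℝ) / J) (((i : ℝ) + 1) / J), Φ x ≤ (1 / (J : ℝ)) * ((F : ℝ) / D) := by
    have hc : ∫ _ in Set.Ioc ((i : ℝ) / J) (((i : ℝ) + 1) / J), (F : ℝ) / D = (1 / (J : ℝ)) * ((F : ℝ) / D) := by
      rw [setIntegral_const, Real.volume_real_Ioc_of_le hab, smul_eq_mul]
      field_simp
      ring
    rw [← hc]
    exact setIntegral_mono_on (hint _ _) (integrableOn_const (by rw [Real.volume_Ioc]; exact ENNReal.ofReal_ne_top))
      measurableSet_Ioc hF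
  have hce : (F : ℝ) / J ≤ (((F + J - 1) / J : ℕ) : ℝ) := by
    rw [div_le_iff₀ hJr]
    have h := le_mul_ceilDiv F hJ
    calc (F : ℝ) ≤ ((J * ((F + J - 1) / J) : ℕ) : ℝ) := by exact_mod_cast h
      _ = (((F + J - 1) / J : ℕ) : ℝ) * J := by push_cast; ring
  calc Ψ ((i : ℝ) / J) + ∫ x in Set.Ioc ((i : ℝ) / J) (((i : ℝ) + 1) / J), Φ x
      ≤ (P : ℝ) / D + (1 / (J : ℝ)) * ((F : ℝ) / D) := add_le_add hP hI
    _ ≤ (P : ℝ) / D + (((F + J - 1) / J : ℕ) : ℝ) / D := by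
        have h2 : 1 / (J : ℝ) * ((F : ℝ) / D) ≤ (((F + J - 1) / J : ℕ) : ℝ) / D := by
          calc 1 / (J : ℝ) * ((F : ℝ) / D) = ((F : ℝ) / J) / D := by ring
            _ ≤ (((F + J - 1) / J : ℕ) : ℝ) / D := div_le_div_of_nonneg_right hce hDr.le
        linarith
    _ = ((P + (F + J - 1) / J : ℕ) : ℝ) / D := by push_cast; ring

/-! ### Soundness of a generation walk -/

/-- `headD` is `getD 0`. [folklore] -/
theorem headD_eq_getD (l : List ℕ) : l.headD 0 = l.getD 0 0 := by
  cases l <;> simp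

/-- **Soundness of the generation walk.**  Let `Ψ ≥ 0` be monotone, `Φ(x) = (1 + Ψ(x − ν))/x` on `(ν, 7ν)` with
`ν = K/J` (`K ≥ 1`), `Φ` integrable on bounded intervals and `Ψ(b) = Ψ(a) + ∫_{(a,b]} Φ` (`0 ≤ a ≤ b`).  If at the
start cell `i ≥ K` (with `i + n < 7K`) the running values bound `Ψ(x_i)` and the lag lists bound `Ψ(x_{i+j−K})` from
below / `Ψ(x_{i+j+1−K})` from above for `j < n`, then the walk's outputs bound `Φ` on every cell `(x_{i+j}, x_{i+j+1}]`,
`Ψ` at every grid point `x_{i+j}`, and the final values bound `Ψ(x_{i+n})` (all `D`-scaled, `x_m = m/J`). [folklore] -/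
theorem tabGen_sound {Φ Ψ : ℝ → ℝ} {J K D : ℕ} (hJ : 0 < J) (hD : 0 < D) (hK : 1 ≤ K)
    (hΨm : Monotone Ψ) (hΨ0 : ∀ y, 0 ≤ Ψ y)
    (hvolt : ∀ x, (K : ℝ) / J < x → x < 7 * ((K : ℝ) / J) → Φ x = (1 + Ψ (x - K / J)) / x)
    (hint : ∀ a b : ℝ, IntegrableOn Φ (Set.Ioc a b))
    (hsplit : ∀ a b : ℝ, 0 ≤ a → a ≤ b → Ψ b = Ψ a + ∫ x in Set.Ioc a b, Φ x) :
    ∀ (n i : ℕ) (ll lh : List ℕ) (pl ph : ℕ), K ≤ i → i + n < 7 * K →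
      (pl : ℝ) / D ≤ Ψ ((i : ℝ) / J) → Ψ ((i : ℝ) / J) ≤ (ph : ℝ) / D →
      (∀ j < n, ((ll.getD j 0 : ℕ) : ℝ) / D ≤ Ψ (((i + j - K : ℕ) : ℝ) / J)) →
      (∀ j < n, Ψ (((i + j + 1 - K : ℕ) : ℝ) / J) ≤ ((lh.getD j 0 : ℕ) : ℝ) / D) →
      (∀ j < n, ∀ x ∈ Set.Ioc (((i + j : ℕ) : ℝ) / J) ((((i + j : ℕ) : ℝ) + 1) / J),
          (((tabGen J D i n ll lh pl ph).phiLo.getD j 0 : ℕ) : ℝ) / D ≤ Φ x ∧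
            Φ x ≤ (((tabGen J D i n ll lh pl ph).phiHi.getD j 0 : ℕ) : ℝ) / D) ∧
      (∀ j < n, (((tabGen J D i n ll lh pl ph).psiLo.getD j 0 : ℕ) : ℝ) / D ≤ Ψ (((i + j : ℕ) : ℝ) / J) ∧
          Ψ (((i + j : ℕ) : ℝ) / J) ≤ (((tabGen J D i n ll lh pl ph).psiHi.getD j 0 : ℕ) : ℝ) / D) ∧
      (((tabGen J D i n ll lh pl ph).pl : ℝ) / D ≤ Ψ (((i + n : ℕ) : ℝ) / J) ∧
        Ψ (((i + n : ℕ) : ℝ) / J) ≤ (((tabGen J D i n ll lh pl ph).ph : ℕ) : ℝ) / D) := by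
  intro n
  induction n with
  | zero =>
    intro i ll lh pl ph _ _ hpl hph _ _
    refine ⟨fun j hj => absurd hj (Nat.not_lt_zero j), fun j hj => absurd hj (Nat.not_lt_zero j), ?_⟩
    simp only [tabGen, tabWalk, Nat.add_zero]
    exact ⟨hpl, hph⟩
  | succ n ih =>
    intro i ll lh pl ph hi hin hpl hph hll hlh
    obtain ⟨e1, e2, e3, e4, e5, e6⟩ := tabGen_succ J D i n ll lh pl ph
    -- the head cell `i`
    have hL0 : ((ll.headD 0 : ℕ) : ℝ) / D ≤ Ψ (((i - K : ℕ) : ℝ) / J) := by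
      have h := hll 0 (Nat.succ_pos n)
      rw [headD_eq_getD]; simpa using h
    have hH0 : Ψ (((i + 1 - K : ℕ) : ℝ) / J) ≤ ((lh.headD 0 : ℕ) : ℝ) / D := by
      have h := hlh 0 (Nat.succ_pos n)
      rw [headD_eq_getD]; simpa using h
    have hi7 : i + 1 < 7 * K := by omega
    have hcellLo : ∀ x ∈ Set.Ioc ((i : ℝ) / J) (((i : ℝ) + 1) / J),
        ((((D + ll.headD 0) * J) / (i + 1) : ℕ) : ℝ) / D ≤ Φ x :=
      fun x hx => cell_lower hJ hD hΨm hΨ0 hvolt hi hi7 hL0 hx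
    have hcellHi : ∀ x ∈ Set.Ioc ((i : ℝ) / J) (((i : ℝ) + 1) / J),
        Φ x ≤ ((((D + lh.headD 0) * J + i - 1) / i : ℕ) : ℝ) / D :=
      fun x hx => cell_upper hJ hD hΨm hvolt hK hi hi7 hH0 hx
    have hpl' : (((pl + ((D + ll.headD 0) * J) / (i + 1) / J : ℕ) : ℝ)) / D ≤ Ψ (((i : ℝ) + 1) / J) :=
      psi_lower_step hJ hD hint hsplit hpl hcellLo
    have hph' : Ψ (((i : ℝ) + 1) / J) ≤
        (((ph + (((D + lh.headD 0) * J + i - 1) / i + J - 1) / J : ℕ) : ℝ)) / D :=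
      psi_upper_step hJ hD hint hsplit hph hcellHi
    -- the induction hypothesis for the rest of the walk
    have hrest := ih (i + 1) ll.tail lh.tail _ _ (by omega) (by omega)
      (by push_cast; exact hpl') (by push_cast; exact hph')
      (fun j hj => by
        rw [Literature.LinearAlgebra.Matrix.ModDiag.getD_tail, show i + 1 + j - K = i + (j + 1) - K by omega]
        exact hll (j + 1) (by omega))
      (fun j hj => by
        rw [Literature.LinearAlgebra.Matrix.ModDiag.getD_tail, show i + 1 + j + 1 - K = i + (j + 1) + 1 - K by omega]
        exact hlh (j + 1) (by omega))
    obtain ⟨r1, r2, r3⟩ := hrest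
    refine ⟨fun j hj x hx => ?_, fun j hj => ?_, ?_⟩
    · rw [e1, e2]
      cases j with
      | zero =>
        simp only [List.getD_cons_zero, Nat.add_zero] at hx ⊢
        exact ⟨hcellLo x hx, hcellHi x hx⟩
      | succ j =>
        simp only [List.getD_cons_succ]
        have e : i + (j + 1) = i + 1 + j := by omega
        rw [e] at hx
        exact r1 j (by omega) x hx
    · rw [e3, e4]
      cases j with
      | zero =>
        simp only [List.getD_cons_zero, Nat.add_zero]
        exact ⟨hpl, hph⟩
      | succ j =>
        simp only [List.getD_cons_succ]
        have e : i + (j + 1) = i + 1 + j := by omega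
        rw [e]
        exact r2 j (by omega)
    · rw [e5, e6, show i + (n + 1) = i + 1 + n by omega]
      exact r3


end Summit.Parity.GeneralizedHardyLittlewood.FordMaynardSieveConst01651SieveConst01651

end
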